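import Mathlib
import HarnessLib
import Summits.CriticalPhenomena.CardyFormulaZ2.Theorems.CardyMagicRigidityMagicFormulaTCountRepresentation3
import Literature.Probability.RandomPlanarGeometry.NestingTransform

/-!
# Line `Sketch` for crux `MagicFormulaT`, sub-goal `threePoint_expect_eq_counts`:
# the count representation of the third-order magic combination at fixed mesh

Crux `Summit.CriticalPhenomena.CardyFormulaZ2.Theses.CardyMagicRigidity.MagicFormulaT`
(stmt-CriticalPhenomena-4836), line `Sketch`, registered sub-goal `threePoint_expect_eq_counts`.
With `θ_u = u.nestingPhase f = ∫_{W(u,·) ≠ 0} f` over the interface loops `u` of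
`siteLoopConfig δ ω` under `triSitePercolation half`, the power sums `A₁ = Σ_u θ_u`,
`A₂ = Σ_u θ_u²`, `A₃ = Σ_u θ_u³`, an admissible density `f` (measurable, `|f| ≤ C`, `f = 0` off
`B̄(0, R)`, `∫ f = 0`) and a mesh `δ > 0`:

`E[3 A₁³ - 12 A₁ A₂ + 8 A₃] = ∭ f f f E[3 N(x) N(y) N(z) - 12 N(x) N(y ∧ z) + 8 N(x ∧ y ∧ z)]`,

where `N(x) = #{u : W(u, x) ≠ 0, u meets B̄(0, R)}` and `N(y ∧ z)`, `N(x ∧ y ∧ z)` are its two- and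
three-point analogues.

* §1 linearity of the triple spatial integral against bounded, jointly measurable kernels
  (`tpc_integrable_levels`, `tpc_integral_lin`, `tpc_triple_integral_lin`): every level of the
  iterated integral is dominated by a constant multiple of `|f|`;
* §2 the abstract statement (`tpc_expect_lin_swap`): pathwise linearity, then the Fubini lemma
  `cr3_integral_swap` for the combined kernel;
* §3 the registered sub-goal: pathwise the three statistics are the triple integrals of
  `cr3_pathwise` (only the finitely many loops meeting `B̄(0, R)` contribute,
  `ncard_loops_siteLoopConfig_meeting_le`), the counts are bounded by the deterministic number of
  loops meeting the ball and jointly measurable (`cr_measurable_ncard_loops`).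

Everything is proved from tree / Mathlib material; no named fact is used; no definition is
introduced.
-/

noncomputable section

namespace Summit.CriticalPhenomena.CardyFormulaZ2.Cruxes.MagicFormulaT.LineSketch

open MeasureTheory Filter Set Metric
open scoped Real Topology BigOperators ENNReal
open Literature.Probability.RandomPlanarGeometry Literature.Probability.Percolation
  Literature.Probability.LatticeModels

/-! ## §1 Linearity of the triple spatial integral against bounded measurable kernels -/

/-- **Every level of `∭ f(x) f(y) f(z) K(x, y, z)` is integrable** for an integrable measurable `f`
and a bounded, jointly measurable kernel `K`: the `z`-integrand is dominated by
`|f x| |f y| B |f z|`, the `y`-integrand by `|f x| B ‖f‖₁ |f y|` and the `x`-integrand by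
`B ‖f‖₁² |f x|`; measurability of the partial integrals is
`MeasureTheory.StronglyMeasurable.integral_prod_right'`. -/
theorem tpc_integrable_levels {f : ℂ → ℝ} (hfi : Integrable f volume) (hfm : Measurable f)
    {K : ℂ → ℂ → ℂ → ℝ} {B : ℝ} (hKB : ∀ x y z, |K x y z| ≤ B)
    (hKm : Measurable fun r : (ℂ × ℂ) × ℂ ↦ K r.1.1 r.1.2 r.2) :
    (∀ x y, Integrable (fun z ↦ f x * f y * f z * K x y z) volume) ∧
    (∀ x, Integrable (fun y ↦ ∫ z, f x * f y * f z * K x y z) volume) ∧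
    Integrable (fun x ↦ ∫ y, ∫ z, f x * f y * f z * K x y z) volume := by
  have hFm : Measurable fun r : (ℂ × ℂ) × ℂ ↦ f r.1.1 * f r.1.2 * f r.2 * K r.1.1 r.1.2 r.2 :=
    (((hfm.comp measurable_fst.fst).mul (hfm.comp measurable_fst.snd)).mul
      (hfm.comp measurable_snd)).mul hKm
  have hpt : ∀ x y z, ‖f x * f y * f z * K x y z‖ ≤ |f x| * |f y| * B * |f z| := fun x y z ↦ by
    rw [Real.norm_eq_abs, abs_mul, abs_mul, abs_mul]
    calc |f x| * |f y| * |f z| * |K x y z| ≤ |f x| * |f y| * |f z| * B :=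
          mul_le_mul_of_nonneg_left (hKB x y z) (by positivity)
      _ = |f x| * |f y| * B * |f z| := by ring
  -- level `z`
  have hIz : ∀ x y, Integrable (fun z ↦ f x * f y * f z * K x y z) volume := fun x y ↦ by
    have hg : Measurable fun z : ℂ ↦ (((x, y), z) : (ℂ × ℂ) × ℂ) :=
      ((measurable_const (a := x)).prodMk (measurable_const (a := y))).prodMk measurable_id
    exact Integrable.mono' (hfi.abs.const_mul (|f x| * |f y| * B))
      (hFm.comp hg).aestronglyMeasurable (Eventually.of_forall fun z ↦ hpt x y z)
  have hbz : ∀ x y, ‖∫ z, f x * f y * f z * K x y z‖ ≤ |f x| * B * (∫ z, |f z|) * |f y| :=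
    fun x y ↦ by
    calc ‖∫ z, f x * f y * f z * K x y z‖ ≤ ∫ z, |f x| * |f y| * B * |f z| :=
          norm_integral_le_of_norm_le (hfi.abs.const_mul _)
            (Eventually.of_forall fun z ↦ hpt x y z)
      _ = |f x| * B * (∫ z, |f z|) * |f y| := by rw [integral_const_mul]; ring
  -- level `y`
  have hsm2 : StronglyMeasurable fun p : ℂ × ℂ ↦ ∫ z, f p.1 * f p.2 * f z * K p.1 p.2 z :=
    hFm.stronglyMeasurable.integral_prod_right'
  have hIy : ∀ x, Integrable (fun y ↦ ∫ z, f x * f y * f z * K x y z) volume := fun x ↦ by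
    have hg : Measurable fun y : ℂ ↦ ((x, y) : ℂ × ℂ) :=
      (measurable_const (a := x)).prodMk measurable_id
    exact Integrable.mono' (hfi.abs.const_mul (|f x| * B * ∫ z, |f z|))
      (hsm2.measurable.comp hg).aestronglyMeasurable (Eventually.of_forall fun y ↦ hbz x y)
  have hby : ∀ x, ‖∫ y, ∫ z, f x * f y * f z * K x y z‖ ≤
      B * (∫ z, |f z|) * (∫ z, |f z|) * |f x| := fun x ↦ by
    calc ‖∫ y, ∫ z, f x * f y * f z * K x y z‖ ≤ ∫ y, |f x| * B * (∫ z, |f z|) * |f y| :=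
          norm_integral_le_of_norm_le (hfi.abs.const_mul _)
            (Eventually.of_forall fun y ↦ hbz x y)
      _ = B * (∫ z, |f z|) * (∫ z, |f z|) * |f x| := by rw [integral_const_mul]; ring
  -- level `x`
  have hsm1 : StronglyMeasurable fun x : ℂ ↦ ∫ y, ∫ z, f x * f y * f z * K x y z :=
    hsm2.integral_prod_right'
  have hIx : Integrable (fun x ↦ ∫ y, ∫ z, f x * f y * f z * K x y z) volume :=
    Integrable.mono' (hfi.abs.const_mul (B * (∫ z, |f z|) * ∫ z, |f z|))
      hsm1.aestronglyMeasurable (Eventually.of_forall fun x ↦ hby x)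
  exact ⟨hIz, hIy, hIx⟩

/-- Linearity of one integral: `∫ (a G₁ - b G₂ + c G₃) = a ∫ G₁ - b ∫ G₂ + c ∫ G₃` for integrable
`G₁, G₂, G₃`. -/
theorem tpc_integral_lin {α : Type*} [MeasurableSpace α] {μ : Measure α} {G₁ G₂ G₃ : α → ℝ}
    (h₁ : Integrable G₁ μ) (h₂ : Integrable G₂ μ) (h₃ : Integrable G₃ μ) (a b c : ℝ) :
    ∫ t, (a * G₁ t - b * G₂ t + c * G₃ t) ∂μ =
      a * (∫ t, G₁ t ∂μ) - b * (∫ t, G₂ t ∂μ) + c * (∫ t, G₃ t ∂μ) := by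
  rw [integral_add ((h₁.const_mul a).sub' (h₂.const_mul b)) (h₃.const_mul c),
    integral_sub (h₁.const_mul a) (h₂.const_mul b), integral_const_mul, integral_const_mul,
    integral_const_mul]

/-- **Linearity of the triple spatial integral against bounded, jointly measurable kernels**:
`∭ f f f (a K₁ - b K₂ + c K₃) = a ∭ f f f K₁ - b ∭ f f f K₂ + c ∭ f f f K₃`
(`tpc_integral_lin` at each of the three levels, which are integrable by
`tpc_integrable_levels`). -/
theorem tpc_triple_integral_lin {f : ℂ → ℝ} (hfi : Integrable f volume) (hfm : Measurable f)
    {K₁ K₂ K₃ : ℂ → ℂ → ℂ → ℝ} {B₁ B₂ B₃ : ℝ} (h₁B : ∀ x y z, |K₁ x y z| ≤ B₁)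
    (h₂B : ∀ x y z, |K₂ x y z| ≤ B₂) (h₃B : ∀ x y z, |K₃ x y z| ≤ B₃)
    (h₁m : Measurable fun r : (ℂ × ℂ) × ℂ ↦ K₁ r.1.1 r.1.2 r.2)
    (h₂m : Measurable fun r : (ℂ × ℂ) × ℂ ↦ K₂ r.1.1 r.1.2 r.2)
    (h₃m : Measurable fun r : (ℂ × ℂ) × ℂ ↦ K₃ r.1.1 r.1.2 r.2) (a b c : ℝ) :
    ∫ x, ∫ y, ∫ z, f x * f y * f z * (a * K₁ x y z - b * K₂ x y z + c * K₃ x y z) =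
      a * (∫ x, ∫ y, ∫ z, f x * f y * f z * K₁ x y z) -
        b * (∫ x, ∫ y, ∫ z, f x * f y * f z * K₂ x y z) +
        c * (∫ x, ∫ y, ∫ z, f x * f y * f z * K₃ x y z) := by
  obtain ⟨h₁z, h₁y, h₁x⟩ := tpc_integrable_levels hfi hfm h₁B h₁m
  obtain ⟨h₂z, h₂y, h₂x⟩ := tpc_integrable_levels hfi hfm h₂B h₂m
  obtain ⟨h₃z, h₃y, h₃x⟩ := tpc_integrable_levels hfi hfm h₃B h₃m
  rw [← tpc_integral_lin h₁x h₂x h₃x]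
  refine integral_congr_ae ?_
  filter_upwards with x
  rw [← tpc_integral_lin (h₁y x) (h₂y x) (h₃y x)]
  refine integral_congr_ae ?_
  filter_upwards with y
  rw [← tpc_integral_lin (h₁z x y) (h₂z x y) (h₃z x y)]
  refine integral_congr_ae ?_
  filter_upwards with z
  ring

/-! ## §2 The abstract statement: linearity and Fubini for three bounded loop kernels -/

/-- **Expectation of a linear combination of triple integrals of bounded loop kernels.**  For a
finite measure `P`, an integrable measurable `f` and three jointly measurable kernels
`Kᵢ ω x y z` with `|Kᵢ| ≤ Bᵢ`:
`E[a ∭ f f f K₁ - b ∭ f f f K₂ + c ∭ f f f K₃] = ∭ f f f E[a K₁ - b K₂ + c K₃]`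
(pathwise `tpc_triple_integral_lin`, then `cr3_integral_swap` for the combined kernel, which is
bounded by `|a| B₁ + |b| B₂ + |c| B₃`). -/
theorem tpc_expect_lin_swap {Ω : Type*} [MeasurableSpace Ω] (P : Measure Ω) [IsFiniteMeasure P]
    {f : ℂ → ℝ} (hfi : Integrable f volume) (hfm : Measurable f)
    {K₁ K₂ K₃ : Ω → ℂ → ℂ → ℂ → ℝ} {B₁ B₂ B₃ : ℝ} (h₁B : ∀ ω x y z, |K₁ ω x y z| ≤ B₁)
    (h₂B : ∀ ω x y z, |K₂ ω x y z| ≤ B₂) (h₃B : ∀ ω x y z, |K₃ ω x y z| ≤ B₃)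
    (h₁m : Measurable fun r : ((Ω × ℂ) × ℂ) × ℂ ↦ K₁ r.1.1.1 r.1.1.2 r.1.2 r.2)
    (h₂m : Measurable fun r : ((Ω × ℂ) × ℂ) × ℂ ↦ K₂ r.1.1.1 r.1.1.2 r.1.2 r.2)
    (h₃m : Measurable fun r : ((Ω × ℂ) × ℂ) × ℂ ↦ K₃ r.1.1.1 r.1.1.2 r.1.2 r.2) (a b c : ℝ) :
    ∫ ω, (a * (∫ x, ∫ y, ∫ z, f x * f y * f z * K₁ ω x y z) -
        b * (∫ x, ∫ y, ∫ z, f x * f y * f z * K₂ ω x y z) +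
        c * (∫ x, ∫ y, ∫ z, f x * f y * f z * K₃ ω x y z)) ∂P =
      ∫ x, ∫ y, ∫ z, f x * f y * f z *
        ∫ ω, (a * K₁ ω x y z - b * K₂ ω x y z + c * K₃ ω x y z) ∂P := by
  -- the kernels at a fixed sample are jointly measurable in the spatial variables
  have hg : ∀ ω : Ω, Measurable fun r : (ℂ × ℂ) × ℂ ↦ ((((ω, r.1.1), r.1.2), r.2) :
      ((Ω × ℂ) × ℂ) × ℂ) := fun ω ↦
    (((measurable_const (a := ω)).prodMk measurable_fst.fst).prodMk measurable_fst.snd).prodMk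
      measurable_snd
  have h₁ω : ∀ ω, Measurable fun r : (ℂ × ℂ) × ℂ ↦ K₁ ω r.1.1 r.1.2 r.2 := fun ω ↦
    h₁m.comp (hg ω)
  have h₂ω : ∀ ω, Measurable fun r : (ℂ × ℂ) × ℂ ↦ K₂ ω r.1.1 r.1.2 r.2 := fun ω ↦
    h₂m.comp (hg ω)
  have h₃ω : ∀ ω, Measurable fun r : (ℂ × ℂ) × ℂ ↦ K₃ ω r.1.1 r.1.2 r.2 := fun ω ↦
    h₃m.comp (hg ω)
  -- the combined kernel is bounded and jointly measurable
  have hKB : ∀ ω x y z, |a * K₁ ω x y z - b * K₂ ω x y z + c * K₃ ω x y z| ≤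
      |a| * B₁ + |b| * B₂ + |c| * B₃ := fun ω x y z ↦ by
    calc |a * K₁ ω x y z - b * K₂ ω x y z + c * K₃ ω x y z|
        ≤ |a * K₁ ω x y z - b * K₂ ω x y z| + |c * K₃ ω x y z| := abs_add_le _ _
      _ ≤ |a * K₁ ω x y z| + |b * K₂ ω x y z| + |c * K₃ ω x y z| :=
          add_le_add (abs_sub _ _) le_rfl
      _ ≤ |a| * B₁ + |b| * B₂ + |c| * B₃ := by
          rw [abs_mul, abs_mul, abs_mul]
          exact add_le_add (add_le_add (mul_le_mul_of_nonneg_left (h₁B ω x y z) (abs_nonneg a))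
            (mul_le_mul_of_nonneg_left (h₂B ω x y z) (abs_nonneg b)))
            (mul_le_mul_of_nonneg_left (h₃B ω x y z) (abs_nonneg c))
  have hKm : Measurable fun r : ((Ω × ℂ) × ℂ) × ℂ ↦ a * K₁ r.1.1.1 r.1.1.2 r.1.2 r.2 -
      b * K₂ r.1.1.1 r.1.1.2 r.1.2 r.2 + c * K₃ r.1.1.1 r.1.1.2 r.1.2 r.2 :=
    ((h₁m.const_mul a).sub (h₂m.const_mul b)).add (h₃m.const_mul c)
  calc ∫ ω, (a * (∫ x, ∫ y, ∫ z, f x * f y * f z * K₁ ω x y z) -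
        b * (∫ x, ∫ y, ∫ z, f x * f y * f z * K₂ ω x y z) +
        c * (∫ x, ∫ y, ∫ z, f x * f y * f z * K₃ ω x y z)) ∂P
      = ∫ ω, (∫ x, ∫ y, ∫ z, f x * f y * f z *
          (a * K₁ ω x y z - b * K₂ ω x y z + c * K₃ ω x y z)) ∂P :=
        integral_congr_ae (Eventually.of_forall fun ω ↦
          (tpc_triple_integral_lin hfi hfm (h₁B ω) (h₂B ω) (h₃B ω) (h₁ω ω) (h₂ω ω) (h₃ω ω)
            a b c).symm)
    _ = _ := cr3_integral_swap P hfi hfm hKB hKm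

/-! ## §3 The registered sub-goal -/

/-- **Sub-goal `threePoint_expect_eq_counts` · count representation of the third-order magic
combination at fixed mesh.**  For an admissible density `f` (measurable, `|f| ≤ C`, `f = 0` off
`B̄(0, R)`, `∫ f = 0`) and a mesh `δ > 0`, with `θ_u = ∫_{W(u,·) ≠ 0} f` over the interface loops
of `siteLoopConfig δ ω` under `triSitePercolation half`, `A₁ = Σ_u θ_u`, `A₂ = Σ_u θ_u²`,
`A₃ = Σ_u θ_u³`, `N(x) = #{u : W(u,x) ≠ 0, u meets B̄(0,R)}` and its two- and three-point
analogues `N(y ∧ z)`, `N(x ∧ y ∧ z)`: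
`E[3 A₁³ - 12 A₁ A₂ + 8 A₃] = ∭ f f f E[3 N(x) N(y) N(z) - 12 N(x) N(y ∧ z) + 8 N(x ∧ y ∧ z)]`.
Pathwise the three statistics are the triple integrals of `cr3_pathwise` (only the finitely many
loops meeting `B̄(0, R)` contribute, `ncard_loops_siteLoopConfig_meeting_le`); the counts are
bounded by the deterministic number of loops meeting the ball and jointly measurable
(`cr_measurable_ncard_loops`), so `tpc_expect_lin_swap` applies. -/
theorem threePoint_expect_eq_counts : ∀ (f : ℂ → ℝ) (R C : ℝ), Measurable f → (∀ z, |f z| ≤ C) →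
    (∀ z, R < ‖z‖ → f z = 0) → ∫ z, f z = 0 → ∀ δ : ℝ, 0 < δ →
    ∫ ω, (3 * (∑ᶠ u ∈ (siteLoopConfig δ ω).loops, u.nestingPhase f) ^ 3 -
      12 * (∑ᶠ u ∈ (siteLoopConfig δ ω).loops, u.nestingPhase f) *
        (∑ᶠ u ∈ (siteLoopConfig δ ω).loops, u.nestingPhase f ^ 2) +
      8 * (∑ᶠ u ∈ (siteLoopConfig δ ω).loops, u.nestingPhase f ^ 3)) ∂(triSitePercolation half) =
    ∫ x, ∫ y, ∫ z, f x * f y * f z * ∫ ω, (3 * ((Set.ncard {u ∈ (siteLoopConfig δ ω).loops | u.wind x ≠ 0 ∧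
        (u.range ∩ Metric.closedBall (0 : ℂ) R).Nonempty} : ℝ) *
        (Set.ncard {u ∈ (siteLoopConfig δ ω).loops | u.wind y ≠ 0 ∧
        (u.range ∩ Metric.closedBall (0 : ℂ) R).Nonempty} : ℝ) *
        (Set.ncard {u ∈ (siteLoopConfig δ ω).loops | u.wind z ≠ 0 ∧
        (u.range ∩ Metric.closedBall (0 : ℂ) R).Nonempty} : ℝ)) -
      12 * ((Set.ncard {u ∈ (siteLoopConfig δ ω).loops | u.wind x ≠ 0 ∧
        (u.range ∩ Metric.closedBall (0 : ℂ) R).Nonempty} : ℝ) *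
        (Set.ncard {u ∈ (siteLoopConfig δ ω).loops | u.wind y ≠ 0 ∧ u.wind z ≠ 0 ∧
        (u.range ∩ Metric.closedBall (0 : ℂ) R).Nonempty} : ℝ)) +
      8 * (Set.ncard {u ∈ (siteLoopConfig δ ω).loops | u.wind x ≠ 0 ∧ u.wind y ≠ 0 ∧ u.wind z ≠ 0 ∧
        (u.range ∩ Metric.closedBall (0 : ℂ) R).Nonempty} : ℝ)) ∂(triSitePercolation half) := by
  intro f R C hf hC hR h0 δ hδ
  have hfi : Integrable f volume := integrable_of_abs_le_of_eq_zero hf hC hR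
  -- finiteness and the deterministic bound on the loops meeting the ball
  have hT : ∀ ω : SiteConfig (Site 2),
      {u ∈ (siteLoopConfig δ ω).loops | (u.range ∩ closedBall (0 : ℂ) R).Nonempty}.Finite :=
    fun ω ↦ (ncard_loops_siteLoopConfig_meeting_le hδ R ω).1
  obtain ⟨Nmax, hNmax⟩ : ∃ N : ℕ, ∀ ω : SiteConfig (Site 2),
      {u ∈ (siteLoopConfig δ ω).loops | (u.range ∩ closedBall (0 : ℂ) R).Nonempty}.ncard ≤ N :=
    ⟨_, fun ω ↦ (ncard_loops_siteLoopConfig_meeting_le hδ R ω).2⟩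
  have hN₁le : ∀ (ω : SiteConfig (Site 2)) (x : ℂ),
      ((Set.ncard {u ∈ (siteLoopConfig δ ω).loops | u.wind x ≠ 0 ∧
        (u.range ∩ closedBall (0 : ℂ) R).Nonempty} : ℝ)) ≤ Nmax := fun ω x ↦ by
    rw [Nat.cast_le]
    refine (Set.ncard_le_ncard (fun u hu ↦ ?_) (hT ω)).trans (hNmax ω)
    exact ⟨hu.1, hu.2.2⟩
  have hN₂le : ∀ (ω : SiteConfig (Site 2)) (y z : ℂ),
      ((Set.ncard {u ∈ (siteLoopConfig δ ω).loops | u.wind y ≠ 0 ∧ u.wind z ≠ 0 ∧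
        (u.range ∩ closedBall (0 : ℂ) R).Nonempty} : ℝ)) ≤ Nmax := fun ω y z ↦ by
    rw [Nat.cast_le]
    refine (Set.ncard_le_ncard (fun u hu ↦ ?_) (hT ω)).trans (hNmax ω)
    exact ⟨hu.1, hu.2.2.2⟩
  have hN₃le : ∀ (ω : SiteConfig (Site 2)) (x y z : ℂ),
      |((Set.ncard {u ∈ (siteLoopConfig δ ω).loops | u.wind x ≠ 0 ∧ u.wind y ≠ 0 ∧
        u.wind z ≠ 0 ∧ (u.range ∩ closedBall (0 : ℂ) R).Nonempty} : ℝ))| ≤ Nmax :=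
    fun ω x y z ↦ by
    rw [Nat.abs_cast, Nat.cast_le]
    refine (Set.ncard_le_ncard (fun u hu ↦ ?_) (hT ω)).trans (hNmax ω)
    exact ⟨hu.1, hu.2.2.2.2⟩
  have hN₁₂le : ∀ (ω : SiteConfig (Site 2)) (x y z : ℂ),
      |((Set.ncard {u ∈ (siteLoopConfig δ ω).loops | u.wind x ≠ 0 ∧
        (u.range ∩ closedBall (0 : ℂ) R).Nonempty} : ℝ)) *
        ((Set.ncard {u ∈ (siteLoopConfig δ ω).loops | u.wind y ≠ 0 ∧ u.wind z ≠ 0 ∧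
        (u.range ∩ closedBall (0 : ℂ) R).Nonempty} : ℝ))| ≤ Nmax * Nmax := fun ω x y z ↦ by
    rw [abs_mul, Nat.abs_cast, Nat.abs_cast]
    exact mul_le_mul (hN₁le ω x) (hN₂le ω y z) (Nat.cast_nonneg _) (Nat.cast_nonneg _)
  have hN₁₁₁le : ∀ (ω : SiteConfig (Site 2)) (x y z : ℂ),
      |((Set.ncard {u ∈ (siteLoopConfig δ ω).loops | u.wind x ≠ 0 ∧
        (u.range ∩ closedBall (0 : ℂ) R).Nonempty} : ℝ)) *
        ((Set.ncard {u ∈ (siteLoopConfig δ ω).loops | u.wind y ≠ 0 ∧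
        (u.range ∩ closedBall (0 : ℂ) R).Nonempty} : ℝ)) *
        ((Set.ncard {u ∈ (siteLoopConfig δ ω).loops | u.wind z ≠ 0 ∧
        (u.range ∩ closedBall (0 : ℂ) R).Nonempty} : ℝ))| ≤ Nmax * Nmax * Nmax :=
    fun ω x y z ↦ by
    rw [abs_mul, abs_mul, Nat.abs_cast, Nat.abs_cast, Nat.abs_cast]
    exact mul_le_mul (mul_le_mul (hN₁le ω x) (hN₁le ω y) (Nat.cast_nonneg _) (Nat.cast_nonneg _))
      (hN₁le ω z) (Nat.cast_nonneg _) (mul_nonneg (Nat.cast_nonneg _) (Nat.cast_nonneg _))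
  -- joint measurability of the counts
  have hwm : ∀ u : UnbasedLoop ℂ, Measurable fun z ↦ u.wind z ≠ 0 := fun u ↦
    measurableSet_setOf.1 (measurableSet_setOf_wind_ne_zero u)
  have hcast : Measurable fun n : ℕ ↦ (n : ℝ) := measurable_from_nat
  have hmN₃ : Measurable fun r : ((SiteConfig (Site 2) × ℂ) × ℂ) × ℂ ↦
      ((Set.ncard {u ∈ (siteLoopConfig δ r.1.1.1).loops | u.wind r.1.1.2 ≠ 0 ∧ u.wind r.1.2 ≠ 0 ∧
        u.wind r.2 ≠ 0 ∧ (u.range ∩ closedBall (0 : ℂ) R).Nonempty} : ℝ)) :=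
    hcast.comp (cr_measurable_ncard_loops hδ R measurable_fst.fst.fst
      (Q := fun r u ↦ u.wind r.1.1.2 ≠ 0 ∧ u.wind r.1.2 ≠ 0 ∧ u.wind r.2 ≠ 0 ∧
        (u.range ∩ closedBall (0 : ℂ) R).Nonempty)
      (fun u ↦ ((hwm u).comp measurable_fst.fst.snd).and (((hwm u).comp measurable_fst.snd).and
        (((hwm u).comp measurable_snd).and measurable_const)))
      fun _ _ hu ↦ hu.2.2.2)
  have hmX : Measurable fun r : ((SiteConfig (Site 2) × ℂ) × ℂ) × ℂ ↦
      ((Set.ncard {u ∈ (siteLoopConfig δ r.1.1.1).loops | u.wind r.1.1.2 ≠ 0 ∧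
        (u.range ∩ closedBall (0 : ℂ) R).Nonempty} : ℝ)) :=
    hcast.comp (cr_measurable_ncard_loops hδ R measurable_fst.fst.fst
      (Q := fun r u ↦ u.wind r.1.1.2 ≠ 0 ∧ (u.range ∩ closedBall (0 : ℂ) R).Nonempty)
      (fun u ↦ ((hwm u).comp measurable_fst.fst.snd).and measurable_const)
      fun _ _ hu ↦ hu.2)
  have hmY : Measurable fun r : ((SiteConfig (Site 2) × ℂ) × ℂ) × ℂ ↦
      ((Set.ncard {u ∈ (siteLoopConfig δ r.1.1.1).loops | u.wind r.1.2 ≠ 0 ∧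
        (u.range ∩ closedBall (0 : ℂ) R).Nonempty} : ℝ)) :=
    hcast.comp (cr_measurable_ncard_loops hδ R measurable_fst.fst.fst
      (Q := fun r u ↦ u.wind r.1.2 ≠ 0 ∧ (u.range ∩ closedBall (0 : ℂ) R).Nonempty)
      (fun u ↦ ((hwm u).comp measurable_fst.snd).and measurable_const)
      fun _ _ hu ↦ hu.2)
  have hmZ : Measurable fun r : ((SiteConfig (Site 2) × ℂ) × ℂ) × ℂ ↦
      ((Set.ncard {u ∈ (siteLoopConfig δ r.1.1.1).loops | u.wind r.2 ≠ 0 ∧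
        (u.range ∩ closedBall (0 : ℂ) R).Nonempty} : ℝ)) :=
    hcast.comp (cr_measurable_ncard_loops hδ R measurable_fst.fst.fst
      (Q := fun r u ↦ u.wind r.2 ≠ 0 ∧ (u.range ∩ closedBall (0 : ℂ) R).Nonempty)
      (fun u ↦ ((hwm u).comp measurable_snd).and measurable_const)
      fun _ _ hu ↦ hu.2)
  have hmYZ : Measurable fun r : ((SiteConfig (Site 2) × ℂ) × ℂ) × ℂ ↦
      ((Set.ncard {u ∈ (siteLoopConfig δ r.1.1.1).loops | u.wind r.1.2 ≠ 0 ∧ u.wind r.2 ≠ 0 ∧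
        (u.range ∩ closedBall (0 : ℂ) R).Nonempty} : ℝ)) :=
    hcast.comp (cr_measurable_ncard_loops hδ R measurable_fst.fst.fst
      (Q := fun r u ↦ u.wind r.1.2 ≠ 0 ∧ u.wind r.2 ≠ 0 ∧
        (u.range ∩ closedBall (0 : ℂ) R).Nonempty)
      (fun u ↦ ((hwm u).comp measurable_fst.snd).and (((hwm u).comp measurable_snd).and
        measurable_const))
      fun _ _ hu ↦ hu.2.2)
  -- pathwise the statistics are triple integrals (`cr3_pathwise`); then `tpc_expect_lin_swap`
  refine Eq.trans (integral_congr_ae ?_)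
    (tpc_expect_lin_swap (triSitePercolation half) hfi hf hN₁₁₁le hN₁₂le hN₃le
      ((hmX.mul hmY).mul hmZ) (hmX.mul hmYZ) hmN₃ 3 12 8)
  filter_upwards with ω
  obtain ⟨h3, h12, h111⟩ := cr3_pathwise hf hC hR h0 (hT ω)
  rw [h111, mul_assoc (12 : ℝ), h12, h3]

end Summit.CriticalPhenomena.CardyFormulaZ2.Cruxes.MagicFormulaT.LineSketch

end
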